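import Literature.Geometry.Kaehler.CyclotomicTwentyEightHodgeConjecture
import Literature.Geometry.Kaehler.CyclotomicThirtySixHodgeConjecture
import Literature.Geometry.Kaehler.CyclotomicTwentyOneHodgeConjecture
import Literature.Geometry.Kaehler.ComplexTorusCyclotomicAutomorphismMumfordTateRankTwo
import Literature.AlgebraicGeometry.ComplexMultiplication.CyclotomicCMTypeIsogenyClasses
import HarnessLib

/-!
# The rank tables of `ℚ(ζ₂₁)`, `ℚ(ζ₂₈)`, `ℚ(ζ₃₆)`: every CM type has Kubota–Dodson rank `7, 6, 4` or `2` — `24, 24, 12, 4` of them — and the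
# Mumford–Tate ranks of the complex `6`-tori with `P_u = Φ₂₁, Φ₂₈, Φ₃₆`

Layer `Literature/Geometry/Kaehler`, namespace `Literature.Geometry.Kaehler.ComplexTorus`; lane `lit-hodgefound`, prover seat `lit-hodgefound-p10`,
generation 34, row «A2-26 (degree-12 rank tables)» (self-proposed 2026-08-28).  Theorems only (no `def`, no named fact; net debt 0).  Completes this
generation's `Cyclotomic{TwentyOne, TwentyEight, ThirtySix}HodgeConjecture` (ranks `7`/`6` of the PRIMITIVE types) by the IMPRIMITIVE ones:

* generic (any `ℚ(ζ_N)`): **`cmTypeRank_eq_succ_of_card_stabilizer_mul_eq`** — if the residue stabiliser `W` of `Φ` has `|W| · 2p = φ(N)` with `p`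
  prime, then `Rank(Φ) = p + 1` (`Φ` is induced from the primitive sub-pair `(K₁, Φ₁)`, `[ℚ(ζ_N) : K₁] = |W|` — Koblitz–Rohrlich —, so `[K₁ : ℚ] = 2p`
  and `Φ₁` is nondegenerate — Ribet —, `Rank(Φ) = Rank(Φ₁) = p + 1`);
* for each of the three fields (`φ = 12`, stabilisers of order `1, 2, 6`): `Rank = 4` for `|W| = 2` (sextic sub-pair), `Rank = 2` for `|W| = 6`
  (imaginary quadratic sub-pair), the full TABLE `cmTypeRank_table_*` (`7`: primitive not coset-balanced; `6`: primitive coset-balanced; `4`; `2`),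
  `cmTypeRank_mem_*`, `isPrimitive_iff_six_le_cmTypeRank_*`, the RANK CENSUS `ncard_cmTypeRank_eq_*` (`24, 24, 12, 4`), and for the complex tori
  with `P_u = Φ_N`: `mtRank_hodgeStructure_mem_and_isSimple_iff_*` (`rank MT ∈ {7, 6, 4, 2}`, simple ⟺ `≥ 6`).

## References

* [Dodson1984] B. Dodson, Trans. AMS 283 (1984), §3.1.0, Thm. 3.2.1.
* [Dodson1987] B. Dodson, *On the Mumford–Tate group of an abelian variety with complex multiplication*, J. Algebra 111 (1987), §1.1 (p. 50).
* [KoblitzRohrlich1978] N. Koblitz, D. Rohrlich, Canad. J. Math. 30 (1978), §1 p. 1184 (`[L : K₁] = |W|`).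
* [Kubota1965] T. Kubota, Trans. AMS 118 (1965), §2 p. 115.
* [Shimura1998] G. Shimura, *Abelian Varieties with Complex Multiplication and Modular Functions* (1998), §8.2 Prop. 26, §8.4.
* [MoonenZarhin1999LowDim] B. Moonen, Yu. Zarhin, Math. Ann. 315 (1999), §1 (1.2).
-/

noncomputable section

open scoped Classical nonZeroDivisors NumberField Manifold ContDiff MatrixGroups
open NumberField Module Polynomial CategoryTheory CategoryTheory.Limits

namespace Literature.Geometry.Kaehler

namespace ComplexTorus

-- `open scoped`: the tree's action of `Aut(ℂ)` on `Hom(K, ℂ)` by composition (`ringEquivCompAction`) is a scoped instance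
open scoped Literature.NumberTheory.ComplexMultiplication
open Literature.AlgebraicGeometry.Motives (CMType HodgeTensorFacts)
open Literature.NumberTheory.ComplexMultiplication (IsPrimitive inducedCMType isPrimitive_iff_forall_eq
  exists_primitive_inducedCMType_eq_of_isCMField)
open Literature.NumberTheory.ComplexMultiplication.CMTypeLattice (periodIso isSimple_periodIso_iff_isPrimitive)
open Literature.AlgebraicGeometry.Pohlmann1968 (cmTypeRank IsNondegenerate isNondegenerate_iff cmTypeRank_inducedCMType
  isNondegenerate_of_isPrimitive_of_prime isPretransitive_ringEquiv_complex)
open Literature.AlgebraicGeometry.Pohlmann1968.Cyclotomic (finrank_eq_totient)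
open Literature.AlgebraicGeometry.ComplexMultiplication (finrank_eq_card_filter_of_primitive one_mem_stabilizerResidues)
open Literature.AlgebraicGeometry.ComplexMultiplication.CMTorus (mtRank_hodgeStructure_periodIso_eq_cmTypeRank)
open Literature.AlgebraicGeometry.ComplexMultiplication.CyclotomicCMTypeResidueSets (unitResidues residueSet HasTrivialStabilizer
  isPrimitive_iff_hasTrivialStabilizer ncard_setOf_eq_card_filter_powerset_half)
open Literature.AlgebraicGeometry.ComplexMultiplication.CyclotomicCMTypeCensusTwentyOne (card_stabilizer_of_not_isPrimitive_twentyOne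
  isCMResidueSet_reps_twentyOne)
open Literature.AlgebraicGeometry.ComplexMultiplication.CyclotomicCMTypeCensusTwentyEight (card_stabilizer_of_not_isPrimitive_twentyEight
  isCMResidueSet_reps_twentyEight)
open Literature.AlgebraicGeometry.ComplexMultiplication.CyclotomicCMTypeCensusThirtySix (card_stabilizer_of_not_isPrimitive_thirtySix
  isCMResidueSet_reps_thirtySix)

/-! ### Generic: the rank of a type induced from a sub-pair of prime half-degree -/

section Generic

variable {N : ℕ} [NeZero N] {L : Type} [Field L] [NumberField L] [IsCyclotomicExtension {N} ℚ L]

/-- **`|W| · 2p = φ(N)`, `p` prime ⟹ `Rank(Φ) = p + 1`**: `Φ` is induced from its primitive sub-pair `(K₁, Φ₁)` (Streng I.3.5), `[ℚ(ζ_N) : K₁] = |W|`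
(Koblitz–Rohrlich), so `[K₁ : ℚ] = 2p` and the primitive `Φ₁` is nondegenerate (Ribet), `Rank(Φ) = Rank(Φ₁) = p + 1` (Kubota, Dodson's `r(ξ) = r(Inf ξ)`).
[cite: KoblitzRohrlich1978, §1 p. 1184] [cite: Dodson1987, §1.1 (p. 50)] [cite: Kubota1965, §2 (p. 115)] [cite: Shimura1998, §8.2 Prop. 26] -/
theorem cmTypeRank_eq_succ_of_card_stabilizer_mul_eq (hN : 2 < N) {p : ℕ} (hp : p.Prime) (Φ : CMType L)
    (hW : ((unitResidues N).filter fun t => ∀ c ∈ unitResidues N, (c * t ∈ residueSet N Φ ↔ c ∈ residueSet N Φ)).card * (2 * p) =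
      N.totient) :
    cmTypeRank Φ = p + 1 := by
  haveI : IsCMField L := IsCyclotomicExtension.Rat.isCMField L (S := ({N} : Set ℕ)) ⟨N, rfl, hN⟩
  obtain ⟨K₁, Φ₁, hCM, h₁, hp₁, -⟩ := exists_primitive_inducedCMType_eq_of_isCMField Φ
  haveI := hCM
  have hdeg : Module.finrank K₁ L = ((unitResidues N).filter fun t =>
      ∀ c ∈ unitResidues N, (c * t ∈ residueSet N Φ ↔ c ∈ residueSet N Φ)).card :=
    finrank_eq_card_filter_of_primitive (N := N) Φ Φ₁ h₁ hp₁
  have hmul := Module.finrank_mul_finrank ℚ K₁ L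
  rw [hdeg, finrank_eq_totient N L, ← hW, mul_comm] at hmul
  have hpos : 0 < ((unitResidues N).filter fun t => ∀ c ∈ unitResidues N, (c * t ∈ residueSet N Φ ↔ c ∈ residueSet N Φ)).card := by
    by_contra h0
    have h0' : ((unitResidues N).filter fun t => ∀ c ∈ unitResidues N, (c * t ∈ residueSet N Φ ↔ c ∈ residueSet N Φ)).card = 0 := by omega
    rw [h0', zero_mul] at hW
    exact absurd hW.symm (Nat.totient_pos.2 (by omega)).ne'
  have hK₁ : Module.finrank ℚ K₁ = 2 * p := Nat.eq_of_mul_eq_mul_left hpos hmul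
  obtain ⟨φ₁⟩ : Nonempty (K₁ →+* ℂ) := inferInstance
  haveI := isPretransitive_ringEquiv_complex (K := K₁)
  have hprim : IsPrimitive (ℂ ≃+* ℂ) Φ₁.1 φ₁ := (isPrimitive_iff_forall_eq Φ₁.1 φ₁).2 fun s t hst ↦ hp₁ s t hst
  have hnd := isNondegenerate_of_isPrimitive_of_prime (Φ := Φ₁) hp hK₁ φ₁ hprim
  rw [← h₁, cmTypeRank_inducedCMType, (isNondegenerate_iff Φ₁).1 hnd, hK₁]
  omega

/-- The stabiliser of a residue set with trivial stabiliser is `{1}`. [cite: Shimura1998, §8.4 Example (1)] -/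
theorem card_stabilizer_eq_one_of_hasTrivialStabilizer (Φ : CMType L) (h : HasTrivialStabilizer N (residueSet N Φ)) :
    ((unitResidues N).filter fun t => ∀ c ∈ unitResidues N, (c * t ∈ residueSet N Φ ↔ c ∈ residueSet N Φ)).card = 1 := by
  rw [Finset.card_eq_one]
  refine ⟨1, Finset.eq_singleton_iff_unique_mem.2 ⟨one_mem_stabilizerResidues (N := N) Φ, fun t ht ↦ ?_⟩⟩
  rw [Finset.mem_filter] at ht
  exact h t ht.1 ht.2

end Generic

/-! ### `ℚ(ζ₂₁)` -/

section TwentyOne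

variable {K : Type} [Field K] [NumberField K] [IsCyclotomicExtension {21} ℚ K]

/-- **`Rank = 4` for the types of `ℚ(ζ₂₁)` with residue stabiliser of order `2`** (induced from a primitive type of one of the two sextic CM
subfields, rank `3 + 1`). [cite: Dodson1987, §1.1 (p. 50)] [cite: KoblitzRohrlich1978, §1 p. 1184] [cite: Kubota1965, §2 (p. 115)] -/
theorem cmTypeRank_eq_four_of_card_stabilizer_eq_two_twentyOne (Φ : CMType K) (hW : ((unitResidues 21).filter fun t => ∀ c ∈ unitResidues 21, (c * t ∈ residueSet 21 Φ ↔ c ∈ residueSet 21 Φ)).card = 2) :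
    cmTypeRank Φ = 4 :=
  cmTypeRank_eq_succ_of_card_stabilizer_mul_eq (N := 21) (by norm_num) Nat.prime_three Φ (by rw [hW]; decide)

/-- **`Rank = 2` for the types of `ℚ(ζ₂₁)` with residue stabiliser of order `6`** (induced from an imaginary quadratic subfield).
[cite: Dodson1987, §1.1 (p. 50)] [cite: Kubota1965, §2 (p. 115)] -/
theorem cmTypeRank_eq_two_of_card_stabilizer_eq_six_twentyOne (Φ : CMType K) (hW : ((unitResidues 21).filter fun t => ∀ c ∈ unitResidues 21, (c * t ∈ residueSet 21 Φ ↔ c ∈ residueSet 21 Φ)).card = 6) :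
    cmTypeRank Φ = 2 :=
  cmTypeRank_eq_two_of_two_mul_card_filter_eq (N := 21) (by norm_num) Φ (by rw [hW]; decide)

/-- **The imprimitive types of `ℚ(ζ₂₁)` have rank `4` (stabiliser of order `2`) or `2` (order `6`).** [cite: Dodson1987, §1.1 (p. 50)]
[cite: Shimura1998, §8.4 Example (2)(A), p. 65] -/
theorem cmTypeRank_eq_four_or_two_of_not_isPrimitive_twentyOne (Φ : CMType K) (φ₀ : K →+* ℂ) (hΦ : ¬IsPrimitive (ℂ ≃+* ℂ) Φ.1 φ₀) :
    (((unitResidues 21).filter fun t => ∀ c ∈ unitResidues 21, (c * t ∈ residueSet 21 Φ ↔ c ∈ residueSet 21 Φ)).card = 2 ∧ cmTypeRank Φ = 4) ∨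
    (((unitResidues 21).filter fun t => ∀ c ∈ unitResidues 21, (c * t ∈ residueSet 21 Φ ↔ c ∈ residueSet 21 Φ)).card = 6 ∧ cmTypeRank Φ = 2) := by
  rcases card_stabilizer_of_not_isPrimitive_twentyOne Φ φ₀ hΦ with h | h
  · exact Or.inl ⟨h, cmTypeRank_eq_four_of_card_stabilizer_eq_two_twentyOne Φ h⟩
  · exact Or.inr ⟨h, cmTypeRank_eq_two_of_card_stabilizer_eq_six_twentyOne Φ h⟩

/-- **THE RANK TABLE OF `ℚ(ζ₂₁)`**: every CM type has rank `7` (primitive, not coset-balanced: `24` types), `6` (primitive, coset-balanced for `W₁` or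
`W₂` — Dodson's degenerate types: `24`), `4` (stabiliser of order `2`: `12`) or `2` (stabiliser of order `6`: `4`).
[cite: Dodson1984, §3.1.0 and Thm. 3.2.1] [cite: Dodson1987, §1.1 (p. 50)] [cite: Shimura1998, §8.4] -/
theorem cmTypeRank_table_twentyOne (Φ : CMType K) (φ₀ : K →+* ℂ) :
    (IsPrimitive (ℂ ≃+* ℂ) Φ.1 φ₀ ∧ ¬(∀ c ∈ unitResidues 21, ((({1, 4, 10, 13, 16, 19} : Finset (ZMod 21))).filter fun w => c * w ∈ residueSet 21 Φ).card =
        ((({1, 4, 10, 13, 16, 19} : Finset (ZMod 21))).filter fun w => c * w ∉ residueSet 21 Φ).card) ∧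
      ¬(∀ c ∈ unitResidues 21, ((({1, 2, 4, 8, 11, 16} : Finset (ZMod 21))).filter fun w => c * w ∈ residueSet 21 Φ).card =
        ((({1, 2, 4, 8, 11, 16} : Finset (ZMod 21))).filter fun w => c * w ∉ residueSet 21 Φ).card) ∧ cmTypeRank Φ = 7) ∨
    (IsPrimitive (ℂ ≃+* ℂ) Φ.1 φ₀ ∧ ((∀ c ∈ unitResidues 21, ((({1, 4, 10, 13, 16, 19} : Finset (ZMod 21))).filter fun w => c * w ∈ residueSet 21 Φ).card =
        ((({1, 4, 10, 13, 16, 19} : Finset (ZMod 21))).filter fun w => c * w ∉ residueSet 21 Φ).card) ∨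
      (∀ c ∈ unitResidues 21, ((({1, 2, 4, 8, 11, 16} : Finset (ZMod 21))).filter fun w => c * w ∈ residueSet 21 Φ).card =
        ((({1, 2, 4, 8, 11, 16} : Finset (ZMod 21))).filter fun w => c * w ∉ residueSet 21 Φ).card)) ∧ cmTypeRank Φ = 6) ∨
    (¬IsPrimitive (ℂ ≃+* ℂ) Φ.1 φ₀ ∧ ((unitResidues 21).filter fun t => ∀ c ∈ unitResidues 21, (c * t ∈ residueSet 21 Φ ↔ c ∈ residueSet 21 Φ)).card = 2 ∧ cmTypeRank Φ = 4) ∨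
    (¬IsPrimitive (ℂ ≃+* ℂ) Φ.1 φ₀ ∧ ((unitResidues 21).filter fun t => ∀ c ∈ unitResidues 21, (c * t ∈ residueSet 21 Φ ↔ c ∈ residueSet 21 Φ)).card = 6 ∧ cmTypeRank Φ = 2) := by
  by_cases hΦ : IsPrimitive (ℂ ≃+* ℂ) Φ.1 φ₀
  · rcases cmTypeRank_eq_seven_or_six_of_isPrimitive_twentyOne Φ φ₀ hΦ with ⟨h₁, h₂, h7⟩ | ⟨hb, h6⟩
    · exact Or.inl ⟨hΦ, h₁, h₂, h7⟩
    · exact Or.inr (Or.inl ⟨hΦ, hb, h6⟩)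
  · rcases cmTypeRank_eq_four_or_two_of_not_isPrimitive_twentyOne Φ φ₀ hΦ with ⟨h2, h4⟩ | ⟨h6, h2'⟩
    · exact Or.inr (Or.inr (Or.inl ⟨hΦ, h2, h4⟩))
    · exact Or.inr (Or.inr (Or.inr ⟨hΦ, h6, h2'⟩))

/-- `Rank ∈ {7, 6, 4, 2}` for every CM type of `ℚ(ζ₂₁)`. [cite: Dodson1984, §3.1.0] [cite: Dodson1987, §1.1 (p. 50)] -/
theorem cmTypeRank_mem_twentyOne (Φ : CMType K) : cmTypeRank Φ = 7 ∨ cmTypeRank Φ = 6 ∨ cmTypeRank Φ = 4 ∨ cmTypeRank Φ = 2 := by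
  obtain ⟨φ₀⟩ : Nonempty (K →+* ℂ) := inferInstance
  rcases cmTypeRank_table_twentyOne Φ φ₀ with ⟨-, -, -, h⟩ | ⟨-, -, h⟩ | ⟨-, -, h⟩ | ⟨-, -, h⟩
  · exact Or.inl h
  · exact Or.inr (Or.inl h)
  · exact Or.inr (Or.inr (Or.inl h))
  · exact Or.inr (Or.inr (Or.inr h))

/-- **Primitive ⟺ rank `≥ 6`** (`7` or `6`), for the CM types of `ℚ(ζ₂₁)`. [cite: Dodson1984, §3.1.0 and Thm. 3.2.1] -/
theorem isPrimitive_iff_six_le_cmTypeRank_twentyOne (Φ : CMType K) (φ₀ : K →+* ℂ) : IsPrimitive (ℂ ≃+* ℂ) Φ.1 φ₀ ↔ 6 ≤ cmTypeRank Φ := by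
  rcases cmTypeRank_table_twentyOne Φ φ₀ with ⟨hp, -, -, h⟩ | ⟨hp, -, h⟩ | ⟨hp, -, h⟩ | ⟨hp, -, h⟩
  · exact ⟨fun _ ↦ by omega, fun _ ↦ hp⟩
  · exact ⟨fun _ ↦ by omega, fun _ ↦ hp⟩
  · exact ⟨fun h' ↦ absurd h' hp, fun h' ↦ by omega⟩
  · exact ⟨fun h' ↦ absurd h' hp, fun h' ↦ by omega⟩

/-- `Rank = 7 ⟺` nondegenerate, for `ℚ(ζ₂₁)` (`n + 1 = 7`). [cite: Dodson1984, §3.1.0] -/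
theorem cmTypeRank_eq_seven_iff_isNondegenerate_twentyOne (Φ : CMType K) : cmTypeRank Φ = 7 ↔ IsNondegenerate Φ := by
  rw [isNondegenerate_iff, finrank_eq_totient 21 K, show Nat.totient 21 / 2 + 1 = 7 by decide]

/-- `Rank = 4 ⟺ |W| = 2` and `Rank = 2 ⟺ |W| = 6`, for `ℚ(ζ₂₁)`. [cite: Dodson1987, §1.1 (p. 50)] [cite: Shimura1998, §8.4 Example (2)(A), p. 65] -/
theorem cmTypeRank_eq_four_iff_and_eq_two_iff_twentyOne (Φ : CMType K) :
    (cmTypeRank Φ = 4 ↔ ((unitResidues 21).filter fun t => ∀ c ∈ unitResidues 21, (c * t ∈ residueSet 21 Φ ↔ c ∈ residueSet 21 Φ)).card = 2) ∧ (cmTypeRank Φ = 2 ↔ ((unitResidues 21).filter fun t => ∀ c ∈ unitResidues 21, (c * t ∈ residueSet 21 Φ ↔ c ∈ residueSet 21 Φ)).card = 6) := by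
  obtain ⟨φ₀⟩ : Nonempty (K →+* ℂ) := inferInstance
  have hone : IsPrimitive (ℂ ≃+* ℂ) Φ.1 φ₀ → ((unitResidues 21).filter fun t => ∀ c ∈ unitResidues 21, (c * t ∈ residueSet 21 Φ ↔ c ∈ residueSet 21 Φ)).card = 1 := fun hp ↦
    card_stabilizer_eq_one_of_hasTrivialStabilizer Φ ((isPrimitive_iff_hasTrivialStabilizer 21 Φ φ₀).1 hp)
  rcases cmTypeRank_table_twentyOne Φ φ₀ with ⟨hp, -, -, h⟩ | ⟨hp, -, h⟩ | ⟨-, hs, h⟩ | ⟨-, hs, h⟩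
  · have h1 := hone hp; rw [h, h1]; omega
  · have h1 := hone hp; rw [h, h1]; omega
  · rw [h, hs]; omega
  · rw [h, hs]; omega

set_option maxRecDepth 100000 in
/-- The rank census on residues (`12` sets with stabiliser of order `2`, `4` with order `6`). [cite: Shimura1998, §8.4 Example (2)(A), p. 65] -/
private theorem card_filter_card_stabilizer_twentyOne' :
    (({1, 2, 4, 5, 8, 10} : Finset (ZMod 21)).powerset.filter (fun T =>
      ((unitResidues 21).filter fun t => ∀ c ∈ unitResidues 21, (c * t ∈ T ∪ (({1, 2, 4, 5, 8, 10} : Finset (ZMod 21)) \ T).image Neg.neg ↔ c ∈ T ∪ (({1, 2, 4, 5, 8, 10} : Finset (ZMod 21)) \ T).image Neg.neg)).card = 2)).card = 12 ∧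
    (({1, 2, 4, 5, 8, 10} : Finset (ZMod 21)).powerset.filter (fun T =>
      ((unitResidues 21).filter fun t => ∀ c ∈ unitResidues 21, (c * t ∈ T ∪ (({1, 2, 4, 5, 8, 10} : Finset (ZMod 21)) \ T).image Neg.neg ↔ c ∈ T ∪ (({1, 2, 4, 5, 8, 10} : Finset (ZMod 21)) \ T).image Neg.neg)).card = 6)).card = 4 := by
  constructor <;> decide +kernel

omit [IsCyclotomicExtension {21} ℚ K] in
/-- **THE RANK CENSUS OF `ℚ(ζ₂₁)`: `24` types of rank `7`, `24` of rank `6`, `12` of rank `4`, `4` of rank `2`** (`64` in all).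
[cite: Dodson1984, §3.1.0 and Thm. 3.2.1] [cite: Dodson1987, §1.1 (p. 50)] [cite: Shimura1998, §8.4] -/
theorem ncard_cmTypeRank_eq_twentyOne (hK : IsCyclotomicExtension {21} ℚ K) :
    {Φ : CMType K | cmTypeRank Φ = 7}.ncard = 24 ∧ {Φ : CMType K | cmTypeRank Φ = 6}.ncard = 24 ∧
      {Φ : CMType K | cmTypeRank Φ = 4}.ncard = 12 ∧ {Φ : CMType K | cmTypeRank Φ = 2}.ncard = 4 := by
  obtain ⟨φ₀⟩ : Nonempty (K →+* ℂ) := inferInstance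
  obtain ⟨h24, h24'⟩ := ncard_isNondegenerate_twentyOne hK φ₀
  have hHcm : Literature.AlgebraicGeometry.ComplexMultiplication.CyclotomicCMTypeResidueSets.IsCMResidueSet 21 ({1, 2, 4, 5, 8, 10} : Finset (ZMod 21)) :=
    (isCMResidueSet_reps_twentyOne).2.2.1
  refine ⟨?_, ?_, ?_, ?_⟩
  · rw [← h24']
    congr 1
    ext Φ
    exact cmTypeRank_eq_seven_iff_isNondegenerate_twentyOne Φ
  · rw [← h24]
    congr 1
    ext Φ
    simp only [Set.mem_setOf_eq]
    rcases cmTypeRank_table_twentyOne Φ φ₀ with ⟨hp, h₁, h₂, h⟩ | ⟨hp, hb, h⟩ | ⟨hp, -, h⟩ | ⟨hp, -, h⟩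
    · rw [h]; exact ⟨fun h' ↦ by omega, fun h' ↦ absurd h'.2 (not_or.2 ⟨h₁, h₂⟩)⟩
    · rw [h]; exact ⟨fun _ ↦ ⟨hp, hb⟩, fun _ ↦ rfl⟩
    · rw [h]; exact ⟨fun h' ↦ by omega, fun h' ↦ absurd h'.1 hp⟩
    · rw [h]; exact ⟨fun h' ↦ by omega, fun h' ↦ absurd h'.1 hp⟩
  · rw [ncard_setOf_eq_card_filter_powerset_half 21 hHcm (fun Φ : CMType K => cmTypeRank Φ = 4)
      (fun S => ((unitResidues 21).filter fun t => ∀ c ∈ unitResidues 21, (c * t ∈ S ↔ c ∈ S)).card = 2) (fun Φ => (cmTypeRank_eq_four_iff_and_eq_two_iff_twentyOne Φ).1)]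
    exact card_filter_card_stabilizer_twentyOne'.1
  · rw [ncard_setOf_eq_card_filter_powerset_half 21 hHcm (fun Φ : CMType K => cmTypeRank Φ = 2)
      (fun S => ((unitResidues 21).filter fun t => ∀ c ∈ unitResidues 21, (c * t ∈ S ↔ c ∈ S)).card = 6) (fun Φ => (cmTypeRank_eq_four_iff_and_eq_two_iff_twentyOne Φ).2)]
    exact card_filter_card_stabilizer_twentyOne'.2

end TwentyOne

section TwentyOneTori

variable {ι : Type} [Fintype ι] [DecidableEq ι] {E : Type} [NormedAddCommGroup E] [NormedSpace ℂ E]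
  {P : (ι → ℝ) ≃L[ℝ] E}

set_option backward.isDefEq.respectTransparency false in -- Mathlib's instance
-- `IsCyclotomicExtension {21} ℚ (CyclotomicField 21 ℚ)` is keyed on `CyclotomicField.algebra`, the goal on `DivisionRing.toRatAlgebra`
/-- **`rank MT(X) ∈ {7, 6, 4, 2}` for every complex torus with an endomorphism of characteristic polynomial `Φ₂₁`**, with `rank MT(X) ≥ 6 ⟺ X` simple
(`7, 6` for the simple ones; `4` when `X ∼ B²` with `B` a simple CM threefold of a sextic subfield, `2` when `X ∼ E⁶`).
[cite: Dodson1984, §3.1.0 and Thm. 3.2.1] [cite: Dodson1987, §1.1 (p. 50)] [cite: MoonenZarhin1999LowDim, §1 (1.2)] -/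
theorem mtRank_hodgeStructure_mem_and_isSimple_iff_twentyOne [HodgeTensorFacts.{0, 0}] {A : Matrix ι ι ℤ} (hA : A ∈ endRingInt P)
    (hP : A.charpoly = cyclotomic 21 ℤ) :
    ((hodgeStructure P 1).mtRank = 7 ∨ (hodgeStructure P 1).mtRank = 6 ∨ (hodgeStructure P 1).mtRank = 4 ∨ (hodgeStructure P 1).mtRank = 2) ∧
      (ComplexTorus.IsSimple P ↔ 6 ≤ (hodgeStructure P 1).mtRank) := by
  have hζ := IsCyclotomicExtension.zeta_spec 21 ℚ (CyclotomicField 21 ℚ)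
  obtain ⟨Φ, I, e, he, he₂, -⟩ := exists_cmType_ideal_iso_of_charpoly_eq_cyclotomic hζ hA hP
  haveI : IsCMField (CyclotomicField 21 ℚ) :=
    IsCyclotomicExtension.Rat.isCMField (CyclotomicField 21 ℚ) (S := ({21} : Set ℕ)) ⟨21, rfl, by norm_num⟩
  obtain ⟨φ₀⟩ : Nonempty (CyclotomicField 21 ℚ →+* ℂ) := inferInstance
  have hXiso : IsIsomorphic P (periodIso Φ I) := ⟨e, he, he₂⟩
  rw [IsIsomorphic.mtRank_hodgeStructure_eq P (periodIso Φ I) (k := 1) hXiso, mtRank_hodgeStructure_periodIso_eq_cmTypeRank Φ I,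
    hXiso.isSimple_iff, isSimple_periodIso_iff_isPrimitive Φ I φ₀]
  exact ⟨cmTypeRank_mem_twentyOne Φ, isPrimitive_iff_six_le_cmTypeRank_twentyOne Φ φ₀⟩

end TwentyOneTori

/-! ### `ℚ(ζ₂₈)` -/

section TwentyEight

variable {K : Type} [Field K] [NumberField K] [IsCyclotomicExtension {28} ℚ K]

/-- **`Rank = 4` for the types of `ℚ(ζ₂₈)` with residue stabiliser of order `2`** (induced from a primitive type of one of the two sextic CM
subfields, rank `3 + 1`). [cite: Dodson1987, §1.1 (p. 50)] [cite: KoblitzRohrlich1978, §1 p. 1184] [cite: Kubota1965, §2 (p. 115)] -/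
theorem cmTypeRank_eq_four_of_card_stabilizer_eq_two_twentyEight (Φ : CMType K) (hW : ((unitResidues 28).filter fun t => ∀ c ∈ unitResidues 28, (c * t ∈ residueSet 28 Φ ↔ c ∈ residueSet 28 Φ)).card = 2) :
    cmTypeRank Φ = 4 :=
  cmTypeRank_eq_succ_of_card_stabilizer_mul_eq (N := 28) (by norm_num) Nat.prime_three Φ (by rw [hW]; decide)

/-- **`Rank = 2` for the types of `ℚ(ζ₂₈)` with residue stabiliser of order `6`** (induced from an imaginary quadratic subfield).
[cite: Dodson1987, §1.1 (p. 50)] [cite: Kubota1965, §2 (p. 115)] -/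
theorem cmTypeRank_eq_two_of_card_stabilizer_eq_six_twentyEight (Φ : CMType K) (hW : ((unitResidues 28).filter fun t => ∀ c ∈ unitResidues 28, (c * t ∈ residueSet 28 Φ ↔ c ∈ residueSet 28 Φ)).card = 6) :
    cmTypeRank Φ = 2 :=
  cmTypeRank_eq_two_of_two_mul_card_filter_eq (N := 28) (by norm_num) Φ (by rw [hW]; decide)

/-- **The imprimitive types of `ℚ(ζ₂₈)` have rank `4` (stabiliser of order `2`) or `2` (order `6`).** [cite: Dodson1987, §1.1 (p. 50)]
[cite: Shimura1998, §8.4 Example (2)(A), p. 65] -/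
theorem cmTypeRank_eq_four_or_two_of_not_isPrimitive_twentyEight (Φ : CMType K) (φ₀ : K →+* ℂ) (hΦ : ¬IsPrimitive (ℂ ≃+* ℂ) Φ.1 φ₀) :
    (((unitResidues 28).filter fun t => ∀ c ∈ unitResidues 28, (c * t ∈ residueSet 28 Φ ↔ c ∈ residueSet 28 Φ)).card = 2 ∧ cmTypeRank Φ = 4) ∨
    (((unitResidues 28).filter fun t => ∀ c ∈ unitResidues 28, (c * t ∈ residueSet 28 Φ ↔ c ∈ residueSet 28 Φ)).card = 6 ∧ cmTypeRank Φ = 2) := by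
  rcases card_stabilizer_of_not_isPrimitive_twentyEight Φ φ₀ hΦ with h | h
  · exact Or.inl ⟨h, cmTypeRank_eq_four_of_card_stabilizer_eq_two_twentyEight Φ h⟩
  · exact Or.inr ⟨h, cmTypeRank_eq_two_of_card_stabilizer_eq_six_twentyEight Φ h⟩

/-- **THE RANK TABLE OF `ℚ(ζ₂₈)`**: every CM type has rank `7` (primitive, not coset-balanced: `24` types), `6` (primitive, coset-balanced for `W₁` or
`W₂` — Dodson's degenerate types: `24`), `4` (stabiliser of order `2`: `12`) or `2` (stabiliser of order `6`: `4`).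
[cite: Dodson1984, §3.1.0 and Thm. 3.2.1] [cite: Dodson1987, §1.1 (p. 50)] [cite: Shimura1998, §8.4] -/
theorem cmTypeRank_table_twentyEight (Φ : CMType K) (φ₀ : K →+* ℂ) :
    (IsPrimitive (ℂ ≃+* ℂ) Φ.1 φ₀ ∧ ¬(∀ c ∈ unitResidues 28, ((({1, 5, 9, 13, 17, 25} : Finset (ZMod 28))).filter fun w => c * w ∈ residueSet 28 Φ).card =
        ((({1, 5, 9, 13, 17, 25} : Finset (ZMod 28))).filter fun w => c * w ∉ residueSet 28 Φ).card) ∧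
      ¬(∀ c ∈ unitResidues 28, ((({1, 9, 11, 15, 23, 25} : Finset (ZMod 28))).filter fun w => c * w ∈ residueSet 28 Φ).card =
        ((({1, 9, 11, 15, 23, 25} : Finset (ZMod 28))).filter fun w => c * w ∉ residueSet 28 Φ).card) ∧ cmTypeRank Φ = 7) ∨
    (IsPrimitive (ℂ ≃+* ℂ) Φ.1 φ₀ ∧ ((∀ c ∈ unitResidues 28, ((({1, 5, 9, 13, 17, 25} : Finset (ZMod 28))).filter fun w => c * w ∈ residueSet 28 Φ).card =
        ((({1, 5, 9, 13, 17, 25} : Finset (ZMod 28))).filter fun w => c * w ∉ residueSet 28 Φ).card) ∨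
      (∀ c ∈ unitResidues 28, ((({1, 9, 11, 15, 23, 25} : Finset (ZMod 28))).filter fun w => c * w ∈ residueSet 28 Φ).card =
        ((({1, 9, 11, 15, 23, 25} : Finset (ZMod 28))).filter fun w => c * w ∉ residueSet 28 Φ).card)) ∧ cmTypeRank Φ = 6) ∨
    (¬IsPrimitive (ℂ ≃+* ℂ) Φ.1 φ₀ ∧ ((unitResidues 28).filter fun t => ∀ c ∈ unitResidues 28, (c * t ∈ residueSet 28 Φ ↔ c ∈ residueSet 28 Φ)).card = 2 ∧ cmTypeRank Φ = 4) ∨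
    (¬IsPrimitive (ℂ ≃+* ℂ) Φ.1 φ₀ ∧ ((unitResidues 28).filter fun t => ∀ c ∈ unitResidues 28, (c * t ∈ residueSet 28 Φ ↔ c ∈ residueSet 28 Φ)).card = 6 ∧ cmTypeRank Φ = 2) := by
  by_cases hΦ : IsPrimitive (ℂ ≃+* ℂ) Φ.1 φ₀
  · rcases cmTypeRank_eq_seven_or_six_of_isPrimitive_twentyEight Φ φ₀ hΦ with ⟨h₁, h₂, h7⟩ | ⟨hb, h6⟩
    · exact Or.inl ⟨hΦ, h₁, h₂, h7⟩
    · exact Or.inr (Or.inl ⟨hΦ, hb, h6⟩)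
  · rcases cmTypeRank_eq_four_or_two_of_not_isPrimitive_twentyEight Φ φ₀ hΦ with ⟨h2, h4⟩ | ⟨h6, h2'⟩
    · exact Or.inr (Or.inr (Or.inl ⟨hΦ, h2, h4⟩))
    · exact Or.inr (Or.inr (Or.inr ⟨hΦ, h6, h2'⟩))

/-- `Rank ∈ {7, 6, 4, 2}` for every CM type of `ℚ(ζ₂₈)`. [cite: Dodson1984, §3.1.0] [cite: Dodson1987, §1.1 (p. 50)] -/
theorem cmTypeRank_mem_twentyEight (Φ : CMType K) : cmTypeRank Φ = 7 ∨ cmTypeRank Φ = 6 ∨ cmTypeRank Φ = 4 ∨ cmTypeRank Φ = 2 := by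
  obtain ⟨φ₀⟩ : Nonempty (K →+* ℂ) := inferInstance
  rcases cmTypeRank_table_twentyEight Φ φ₀ with ⟨-, -, -, h⟩ | ⟨-, -, h⟩ | ⟨-, -, h⟩ | ⟨-, -, h⟩
  · exact Or.inl h
  · exact Or.inr (Or.inl h)
  · exact Or.inr (Or.inr (Or.inl h))
  · exact Or.inr (Or.inr (Or.inr h))

/-- **Primitive ⟺ rank `≥ 6`** (`7` or `6`), for the CM types of `ℚ(ζ₂₈)`. [cite: Dodson1984, §3.1.0 and Thm. 3.2.1] -/
theorem isPrimitive_iff_six_le_cmTypeRank_twentyEight (Φ : CMType K) (φ₀ : K →+* ℂ) : IsPrimitive (ℂ ≃+* ℂ) Φ.1 φ₀ ↔ 6 ≤ cmTypeRank Φ := by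
  rcases cmTypeRank_table_twentyEight Φ φ₀ with ⟨hp, -, -, h⟩ | ⟨hp, -, h⟩ | ⟨hp, -, h⟩ | ⟨hp, -, h⟩
  · exact ⟨fun _ ↦ by omega, fun _ ↦ hp⟩
  · exact ⟨fun _ ↦ by omega, fun _ ↦ hp⟩
  · exact ⟨fun h' ↦ absurd h' hp, fun h' ↦ by omega⟩
  · exact ⟨fun h' ↦ absurd h' hp, fun h' ↦ by omega⟩

/-- `Rank = 7 ⟺` nondegenerate, for `ℚ(ζ₂₈)` (`n + 1 = 7`). [cite: Dodson1984, §3.1.0] -/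
theorem cmTypeRank_eq_seven_iff_isNondegenerate_twentyEight (Φ : CMType K) : cmTypeRank Φ = 7 ↔ IsNondegenerate Φ := by
  rw [isNondegenerate_iff, finrank_eq_totient 28 K, show Nat.totient 28 / 2 + 1 = 7 by decide]

/-- `Rank = 4 ⟺ |W| = 2` and `Rank = 2 ⟺ |W| = 6`, for `ℚ(ζ₂₈)`. [cite: Dodson1987, §1.1 (p. 50)] [cite: Shimura1998, §8.4 Example (2)(A), p. 65] -/
theorem cmTypeRank_eq_four_iff_and_eq_two_iff_twentyEight (Φ : CMType K) :
    (cmTypeRank Φ = 4 ↔ ((unitResidues 28).filter fun t => ∀ c ∈ unitResidues 28, (c * t ∈ residueSet 28 Φ ↔ c ∈ residueSet 28 Φ)).card = 2) ∧ (cmTypeRank Φ = 2 ↔ ((unitResidues 28).filter fun t => ∀ c ∈ unitResidues 28, (c * t ∈ residueSet 28 Φ ↔ c ∈ residueSet 28 Φ)).card = 6) := by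
  obtain ⟨φ₀⟩ : Nonempty (K →+* ℂ) := inferInstance
  have hone : IsPrimitive (ℂ ≃+* ℂ) Φ.1 φ₀ → ((unitResidues 28).filter fun t => ∀ c ∈ unitResidues 28, (c * t ∈ residueSet 28 Φ ↔ c ∈ residueSet 28 Φ)).card = 1 := fun hp ↦
    card_stabilizer_eq_one_of_hasTrivialStabilizer Φ ((isPrimitive_iff_hasTrivialStabilizer 28 Φ φ₀).1 hp)
  rcases cmTypeRank_table_twentyEight Φ φ₀ with ⟨hp, -, -, h⟩ | ⟨hp, -, h⟩ | ⟨-, hs, h⟩ | ⟨-, hs, h⟩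
  · have h1 := hone hp; rw [h, h1]; omega
  · have h1 := hone hp; rw [h, h1]; omega
  · rw [h, hs]; omega
  · rw [h, hs]; omega

set_option maxRecDepth 100000 in
/-- The rank census on residues (`12` sets with stabiliser of order `2`, `4` with order `6`). [cite: Shimura1998, §8.4 Example (2)(A), p. 65] -/
private theorem card_filter_card_stabilizer_twentyEight' :
    (({1, 3, 5, 9, 11, 15} : Finset (ZMod 28)).powerset.filter (fun T =>
      ((unitResidues 28).filter fun t => ∀ c ∈ unitResidues 28, (c * t ∈ T ∪ (({1, 3, 5, 9, 11, 15} : Finset (ZMod 28)) \ T).image Neg.neg ↔ c ∈ T ∪ (({1, 3, 5, 9, 11, 15} : Finset (ZMod 28)) \ T).image Neg.neg)).card = 2)).card = 12 ∧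
    (({1, 3, 5, 9, 11, 15} : Finset (ZMod 28)).powerset.filter (fun T =>
      ((unitResidues 28).filter fun t => ∀ c ∈ unitResidues 28, (c * t ∈ T ∪ (({1, 3, 5, 9, 11, 15} : Finset (ZMod 28)) \ T).image Neg.neg ↔ c ∈ T ∪ (({1, 3, 5, 9, 11, 15} : Finset (ZMod 28)) \ T).image Neg.neg)).card = 6)).card = 4 := by
  constructor <;> decide +kernel

omit [IsCyclotomicExtension {28} ℚ K] in
/-- **THE RANK CENSUS OF `ℚ(ζ₂₈)`: `24` types of rank `7`, `24` of rank `6`, `12` of rank `4`, `4` of rank `2`** (`64` in all).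
[cite: Dodson1984, §3.1.0 and Thm. 3.2.1] [cite: Dodson1987, §1.1 (p. 50)] [cite: Shimura1998, §8.4] -/
theorem ncard_cmTypeRank_eq_twentyEight (hK : IsCyclotomicExtension {28} ℚ K) :
    {Φ : CMType K | cmTypeRank Φ = 7}.ncard = 24 ∧ {Φ : CMType K | cmTypeRank Φ = 6}.ncard = 24 ∧
      {Φ : CMType K | cmTypeRank Φ = 4}.ncard = 12 ∧ {Φ : CMType K | cmTypeRank Φ = 2}.ncard = 4 := by
  obtain ⟨φ₀⟩ : Nonempty (K →+* ℂ) := inferInstance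
  obtain ⟨h24, h24'⟩ := ncard_isNondegenerate_twentyEight hK φ₀
  have hHcm : Literature.AlgebraicGeometry.ComplexMultiplication.CyclotomicCMTypeResidueSets.IsCMResidueSet 28 ({1, 3, 5, 9, 11, 15} : Finset (ZMod 28)) :=
    (isCMResidueSet_reps_twentyEight).2.2.1
  refine ⟨?_, ?_, ?_, ?_⟩
  · rw [← h24']
    congr 1
    ext Φ
    exact cmTypeRank_eq_seven_iff_isNondegenerate_twentyEight Φ
  · rw [← h24]
    congr 1
    ext Φ
    simp only [Set.mem_setOf_eq]
    rcases cmTypeRank_table_twentyEight Φ φ₀ with ⟨hp, h₁, h₂, h⟩ | ⟨hp, hb, h⟩ | ⟨hp, -, h⟩ | ⟨hp, -, h⟩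
    · rw [h]; exact ⟨fun h' ↦ by omega, fun h' ↦ absurd h'.2 (not_or.2 ⟨h₁, h₂⟩)⟩
    · rw [h]; exact ⟨fun _ ↦ ⟨hp, hb⟩, fun _ ↦ rfl⟩
    · rw [h]; exact ⟨fun h' ↦ by omega, fun h' ↦ absurd h'.1 hp⟩
    · rw [h]; exact ⟨fun h' ↦ by omega, fun h' ↦ absurd h'.1 hp⟩
  · rw [ncard_setOf_eq_card_filter_powerset_half 28 hHcm (fun Φ : CMType K => cmTypeRank Φ = 4)
      (fun S => ((unitResidues 28).filter fun t => ∀ c ∈ unitResidues 28, (c * t ∈ S ↔ c ∈ S)).card = 2) (fun Φ => (cmTypeRank_eq_four_iff_and_eq_two_iff_twentyEight Φ).1)]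
    exact card_filter_card_stabilizer_twentyEight'.1
  · rw [ncard_setOf_eq_card_filter_powerset_half 28 hHcm (fun Φ : CMType K => cmTypeRank Φ = 2)
      (fun S => ((unitResidues 28).filter fun t => ∀ c ∈ unitResidues 28, (c * t ∈ S ↔ c ∈ S)).card = 6) (fun Φ => (cmTypeRank_eq_four_iff_and_eq_two_iff_twentyEight Φ).2)]
    exact card_filter_card_stabilizer_twentyEight'.2

end TwentyEight

section TwentyEightTori

variable {ι : Type} [Fintype ι] [DecidableEq ι] {E : Type} [NormedAddCommGroup E] [NormedSpace ℂ E]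
  {P : (ι → ℝ) ≃L[ℝ] E}

set_option backward.isDefEq.respectTransparency false in -- Mathlib's instance
-- `IsCyclotomicExtension {28} ℚ (CyclotomicField 28 ℚ)` is keyed on `CyclotomicField.algebra`, the goal on `DivisionRing.toRatAlgebra`
/-- **`rank MT(X) ∈ {7, 6, 4, 2}` for every complex torus with an endomorphism of characteristic polynomial `Φ₂₈`**, with `rank MT(X) ≥ 6 ⟺ X` simple
(`7, 6` for the simple ones; `4` when `X ∼ B²` with `B` a simple CM threefold of a sextic subfield, `2` when `X ∼ E⁶`).
[cite: Dodson1984, §3.1.0 and Thm. 3.2.1] [cite: Dodson1987, §1.1 (p. 50)] [cite: MoonenZarhin1999LowDim, §1 (1.2)] -/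
theorem mtRank_hodgeStructure_mem_and_isSimple_iff_twentyEight [HodgeTensorFacts.{0, 0}] {A : Matrix ι ι ℤ} (hA : A ∈ endRingInt P)
    (hP : A.charpoly = cyclotomic 28 ℤ) :
    ((hodgeStructure P 1).mtRank = 7 ∨ (hodgeStructure P 1).mtRank = 6 ∨ (hodgeStructure P 1).mtRank = 4 ∨ (hodgeStructure P 1).mtRank = 2) ∧
      (ComplexTorus.IsSimple P ↔ 6 ≤ (hodgeStructure P 1).mtRank) := by
  have hζ := IsCyclotomicExtension.zeta_spec 28 ℚ (CyclotomicField 28 ℚ)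
  obtain ⟨Φ, I, e, he, he₂, -⟩ := exists_cmType_ideal_iso_of_charpoly_eq_cyclotomic hζ hA hP
  haveI : IsCMField (CyclotomicField 28 ℚ) :=
    IsCyclotomicExtension.Rat.isCMField (CyclotomicField 28 ℚ) (S := ({28} : Set ℕ)) ⟨28, rfl, by norm_num⟩
  obtain ⟨φ₀⟩ : Nonempty (CyclotomicField 28 ℚ →+* ℂ) := inferInstance
  have hXiso : IsIsomorphic P (periodIso Φ I) := ⟨e, he, he₂⟩
  rw [IsIsomorphic.mtRank_hodgeStructure_eq P (periodIso Φ I) (k := 1) hXiso, mtRank_hodgeStructure_periodIso_eq_cmTypeRank Φ I,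
    hXiso.isSimple_iff, isSimple_periodIso_iff_isPrimitive Φ I φ₀]
  exact ⟨cmTypeRank_mem_twentyEight Φ, isPrimitive_iff_six_le_cmTypeRank_twentyEight Φ φ₀⟩

end TwentyEightTori

/-! ### `ℚ(ζ₃₆)` -/

section ThirtySix

variable {K : Type} [Field K] [NumberField K] [IsCyclotomicExtension {36} ℚ K]

/-- **`Rank = 4` for the types of `ℚ(ζ₃₆)` with residue stabiliser of order `2`** (induced from a primitive type of one of the two sextic CM
subfields, rank `3 + 1`). [cite: Dodson1987, §1.1 (p. 50)] [cite: KoblitzRohrlich1978, §1 p. 1184] [cite: Kubota1965, §2 (p. 115)] -/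
theorem cmTypeRank_eq_four_of_card_stabilizer_eq_two_thirtySix (Φ : CMType K) (hW : ((unitResidues 36).filter fun t => ∀ c ∈ unitResidues 36, (c * t ∈ residueSet 36 Φ ↔ c ∈ residueSet 36 Φ)).card = 2) :
    cmTypeRank Φ = 4 :=
  cmTypeRank_eq_succ_of_card_stabilizer_mul_eq (N := 36) (by norm_num) Nat.prime_three Φ (by rw [hW]; decide)

/-- **`Rank = 2` for the types of `ℚ(ζ₃₆)` with residue stabiliser of order `6`** (induced from an imaginary quadratic subfield).
[cite: Dodson1987, §1.1 (p. 50)] [cite: Kubota1965, §2 (p. 115)] -/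
theorem cmTypeRank_eq_two_of_card_stabilizer_eq_six_thirtySix (Φ : CMType K) (hW : ((unitResidues 36).filter fun t => ∀ c ∈ unitResidues 36, (c * t ∈ residueSet 36 Φ ↔ c ∈ residueSet 36 Φ)).card = 6) :
    cmTypeRank Φ = 2 :=
  cmTypeRank_eq_two_of_two_mul_card_filter_eq (N := 36) (by norm_num) Φ (by rw [hW]; decide)

/-- **The imprimitive types of `ℚ(ζ₃₆)` have rank `4` (stabiliser of order `2`) or `2` (order `6`).** [cite: Dodson1987, §1.1 (p. 50)]
[cite: Shimura1998, §8.4 Example (2)(A), p. 65] -/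
theorem cmTypeRank_eq_four_or_two_of_not_isPrimitive_thirtySix (Φ : CMType K) (φ₀ : K →+* ℂ) (hΦ : ¬IsPrimitive (ℂ ≃+* ℂ) Φ.1 φ₀) :
    (((unitResidues 36).filter fun t => ∀ c ∈ unitResidues 36, (c * t ∈ residueSet 36 Φ ↔ c ∈ residueSet 36 Φ)).card = 2 ∧ cmTypeRank Φ = 4) ∨
    (((unitResidues 36).filter fun t => ∀ c ∈ unitResidues 36, (c * t ∈ residueSet 36 Φ ↔ c ∈ residueSet 36 Φ)).card = 6 ∧ cmTypeRank Φ = 2) := by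
  rcases card_stabilizer_of_not_isPrimitive_thirtySix Φ φ₀ hΦ with h | h
  · exact Or.inl ⟨h, cmTypeRank_eq_four_of_card_stabilizer_eq_two_thirtySix Φ h⟩
  · exact Or.inr ⟨h, cmTypeRank_eq_two_of_card_stabilizer_eq_six_thirtySix Φ h⟩

/-- **THE RANK TABLE OF `ℚ(ζ₃₆)`**: every CM type has rank `7` (primitive, not coset-balanced: `24` types), `6` (primitive, coset-balanced for `W₁` or
`W₂` — Dodson's degenerate types: `24`), `4` (stabiliser of order `2`: `12`) or `2` (stabiliser of order `6`: `4`).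
[cite: Dodson1984, §3.1.0 and Thm. 3.2.1] [cite: Dodson1987, §1.1 (p. 50)] [cite: Shimura1998, §8.4] -/
theorem cmTypeRank_table_thirtySix (Φ : CMType K) (φ₀ : K →+* ℂ) :
    (IsPrimitive (ℂ ≃+* ℂ) Φ.1 φ₀ ∧ ¬(∀ c ∈ unitResidues 36, ((({1, 5, 13, 17, 25, 29} : Finset (ZMod 36))).filter fun w => c * w ∈ residueSet 36 Φ).card =
        ((({1, 5, 13, 17, 25, 29} : Finset (ZMod 36))).filter fun w => c * w ∉ residueSet 36 Φ).card) ∧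
      ¬(∀ c ∈ unitResidues 36, ((({1, 7, 13, 19, 25, 31} : Finset (ZMod 36))).filter fun w => c * w ∈ residueSet 36 Φ).card =
        ((({1, 7, 13, 19, 25, 31} : Finset (ZMod 36))).filter fun w => c * w ∉ residueSet 36 Φ).card) ∧ cmTypeRank Φ = 7) ∨
    (IsPrimitive (ℂ ≃+* ℂ) Φ.1 φ₀ ∧ ((∀ c ∈ unitResidues 36, ((({1, 5, 13, 17, 25, 29} : Finset (ZMod 36))).filter fun w => c * w ∈ residueSet 36 Φ).card =
        ((({1, 5, 13, 17, 25, 29} : Finset (ZMod 36))).filter fun w => c * w ∉ residueSet 36 Φ).card) ∨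
      (∀ c ∈ unitResidues 36, ((({1, 7, 13, 19, 25, 31} : Finset (ZMod 36))).filter fun w => c * w ∈ residueSet 36 Φ).card =
        ((({1, 7, 13, 19, 25, 31} : Finset (ZMod 36))).filter fun w => c * w ∉ residueSet 36 Φ).card)) ∧ cmTypeRank Φ = 6) ∨
    (¬IsPrimitive (ℂ ≃+* ℂ) Φ.1 φ₀ ∧ ((unitResidues 36).filter fun t => ∀ c ∈ unitResidues 36, (c * t ∈ residueSet 36 Φ ↔ c ∈ residueSet 36 Φ)).card = 2 ∧ cmTypeRank Φ = 4) ∨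
    (¬IsPrimitive (ℂ ≃+* ℂ) Φ.1 φ₀ ∧ ((unitResidues 36).filter fun t => ∀ c ∈ unitResidues 36, (c * t ∈ residueSet 36 Φ ↔ c ∈ residueSet 36 Φ)).card = 6 ∧ cmTypeRank Φ = 2) := by
  by_cases hΦ : IsPrimitive (ℂ ≃+* ℂ) Φ.1 φ₀
  · rcases cmTypeRank_eq_seven_or_six_of_isPrimitive_thirtySix Φ φ₀ hΦ with ⟨h₁, h₂, h7⟩ | ⟨hb, h6⟩
    · exact Or.inl ⟨hΦ, h₁, h₂, h7⟩
    · exact Or.inr (Or.inl ⟨hΦ, hb, h6⟩)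
  · rcases cmTypeRank_eq_four_or_two_of_not_isPrimitive_thirtySix Φ φ₀ hΦ with ⟨h2, h4⟩ | ⟨h6, h2'⟩
    · exact Or.inr (Or.inr (Or.inl ⟨hΦ, h2, h4⟩))
    · exact Or.inr (Or.inr (Or.inr ⟨hΦ, h6, h2'⟩))

/-- `Rank ∈ {7, 6, 4, 2}` for every CM type of `ℚ(ζ₃₆)`. [cite: Dodson1984, §3.1.0] [cite: Dodson1987, §1.1 (p. 50)] -/
theorem cmTypeRank_mem_thirtySix (Φ : CMType K) : cmTypeRank Φ = 7 ∨ cmTypeRank Φ = 6 ∨ cmTypeRank Φ = 4 ∨ cmTypeRank Φ = 2 := by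
  obtain ⟨φ₀⟩ : Nonempty (K →+* ℂ) := inferInstance
  rcases cmTypeRank_table_thirtySix Φ φ₀ with ⟨-, -, -, h⟩ | ⟨-, -, h⟩ | ⟨-, -, h⟩ | ⟨-, -, h⟩
  · exact Or.inl h
  · exact Or.inr (Or.inl h)
  · exact Or.inr (Or.inr (Or.inl h))
  · exact Or.inr (Or.inr (Or.inr h))

/-- **Primitive ⟺ rank `≥ 6`** (`7` or `6`), for the CM types of `ℚ(ζ₃₆)`. [cite: Dodson1984, §3.1.0 and Thm. 3.2.1] -/
theorem isPrimitive_iff_six_le_cmTypeRank_thirtySix (Φ : CMType K) (φ₀ : K →+* ℂ) : IsPrimitive (ℂ ≃+* ℂ) Φ.1 φ₀ ↔ 6 ≤ cmTypeRank Φ := by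
  rcases cmTypeRank_table_thirtySix Φ φ₀ with ⟨hp, -, -, h⟩ | ⟨hp, -, h⟩ | ⟨hp, -, h⟩ | ⟨hp, -, h⟩
  · exact ⟨fun _ ↦ by omega, fun _ ↦ hp⟩
  · exact ⟨fun _ ↦ by omega, fun _ ↦ hp⟩
  · exact ⟨fun h' ↦ absurd h' hp, fun h' ↦ by omega⟩
  · exact ⟨fun h' ↦ absurd h' hp, fun h' ↦ by omega⟩

/-- `Rank = 7 ⟺` nondegenerate, for `ℚ(ζ₃₆)` (`n + 1 = 7`). [cite: Dodson1984, §3.1.0] -/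
theorem cmTypeRank_eq_seven_iff_isNondegenerate_thirtySix (Φ : CMType K) : cmTypeRank Φ = 7 ↔ IsNondegenerate Φ := by
  rw [isNondegenerate_iff, finrank_eq_totient 36 K, show Nat.totient 36 / 2 + 1 = 7 by decide]

/-- `Rank = 4 ⟺ |W| = 2` and `Rank = 2 ⟺ |W| = 6`, for `ℚ(ζ₃₆)`. [cite: Dodson1987, §1.1 (p. 50)] [cite: Shimura1998, §8.4 Example (2)(A), p. 65] -/
theorem cmTypeRank_eq_four_iff_and_eq_two_iff_thirtySix (Φ : CMType K) :
    (cmTypeRank Φ = 4 ↔ ((unitResidues 36).filter fun t => ∀ c ∈ unitResidues 36, (c * t ∈ residueSet 36 Φ ↔ c ∈ residueSet 36 Φ)).card = 2) ∧ (cmTypeRank Φ = 2 ↔ ((unitResidues 36).filter fun t => ∀ c ∈ unitResidues 36, (c * t ∈ residueSet 36 Φ ↔ c ∈ residueSet 36 Φ)).card = 6) := by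
  obtain ⟨φ₀⟩ : Nonempty (K →+* ℂ) := inferInstance
  have hone : IsPrimitive (ℂ ≃+* ℂ) Φ.1 φ₀ → ((unitResidues 36).filter fun t => ∀ c ∈ unitResidues 36, (c * t ∈ residueSet 36 Φ ↔ c ∈ residueSet 36 Φ)).card = 1 := fun hp ↦
    card_stabilizer_eq_one_of_hasTrivialStabilizer Φ ((isPrimitive_iff_hasTrivialStabilizer 36 Φ φ₀).1 hp)
  rcases cmTypeRank_table_thirtySix Φ φ₀ with ⟨hp, -, -, h⟩ | ⟨hp, -, h⟩ | ⟨-, hs, h⟩ | ⟨-, hs, h⟩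
  · have h1 := hone hp; rw [h, h1]; omega
  · have h1 := hone hp; rw [h, h1]; omega
  · rw [h, hs]; omega
  · rw [h, hs]; omega

set_option maxRecDepth 100000 in
/-- The rank census on residues (`12` sets with stabiliser of order `2`, `4` with order `6`). [cite: Shimura1998, §8.4 Example (2)(A), p. 65] -/
private theorem card_filter_card_stabilizer_thirtySix' :
    (({1, 5, 7, 11, 13, 19} : Finset (ZMod 36)).powerset.filter (fun T =>
      ((unitResidues 36).filter fun t => ∀ c ∈ unitResidues 36, (c * t ∈ T ∪ (({1, 5, 7, 11, 13, 19} : Finset (ZMod 36)) \ T).image Neg.neg ↔ c ∈ T ∪ (({1, 5, 7, 11, 13, 19} : Finset (ZMod 36)) \ T).image Neg.neg)).card = 2)).card = 12 ∧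
    (({1, 5, 7, 11, 13, 19} : Finset (ZMod 36)).powerset.filter (fun T =>
      ((unitResidues 36).filter fun t => ∀ c ∈ unitResidues 36, (c * t ∈ T ∪ (({1, 5, 7, 11, 13, 19} : Finset (ZMod 36)) \ T).image Neg.neg ↔ c ∈ T ∪ (({1, 5, 7, 11, 13, 19} : Finset (ZMod 36)) \ T).image Neg.neg)).card = 6)).card = 4 := by
  constructor <;> decide +kernel

omit [IsCyclotomicExtension {36} ℚ K] in
/-- **THE RANK CENSUS OF `ℚ(ζ₃₆)`: `24` types of rank `7`, `24` of rank `6`, `12` of rank `4`, `4` of rank `2`** (`64` in all).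
[cite: Dodson1984, §3.1.0 and Thm. 3.2.1] [cite: Dodson1987, §1.1 (p. 50)] [cite: Shimura1998, §8.4] -/
theorem ncard_cmTypeRank_eq_thirtySix (hK : IsCyclotomicExtension {36} ℚ K) :
    {Φ : CMType K | cmTypeRank Φ = 7}.ncard = 24 ∧ {Φ : CMType K | cmTypeRank Φ = 6}.ncard = 24 ∧
      {Φ : CMType K | cmTypeRank Φ = 4}.ncard = 12 ∧ {Φ : CMType K | cmTypeRank Φ = 2}.ncard = 4 := by
  obtain ⟨φ₀⟩ : Nonempty (K →+* ℂ) := inferInstance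
  obtain ⟨h24, h24'⟩ := ncard_isNondegenerate_thirtySix hK φ₀
  have hHcm : Literature.AlgebraicGeometry.ComplexMultiplication.CyclotomicCMTypeResidueSets.IsCMResidueSet 36 ({1, 5, 7, 11, 13, 19} : Finset (ZMod 36)) :=
    (isCMResidueSet_reps_thirtySix).2.2.1
  refine ⟨?_, ?_, ?_, ?_⟩
  · rw [← h24']
    congr 1
    ext Φ
    exact cmTypeRank_eq_seven_iff_isNondegenerate_thirtySix Φ
  · rw [← h24]
    congr 1
    ext Φ
    simp only [Set.mem_setOf_eq]
    rcases cmTypeRank_table_thirtySix Φ φ₀ with ⟨hp, h₁, h₂, h⟩ | ⟨hp, hb, h⟩ | ⟨hp, -, h⟩ | ⟨hp, -, h⟩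
    · rw [h]; exact ⟨fun h' ↦ by omega, fun h' ↦ absurd h'.2 (not_or.2 ⟨h₁, h₂⟩)⟩
    · rw [h]; exact ⟨fun _ ↦ ⟨hp, hb⟩, fun _ ↦ rfl⟩
    · rw [h]; exact ⟨fun h' ↦ by omega, fun h' ↦ absurd h'.1 hp⟩
    · rw [h]; exact ⟨fun h' ↦ by omega, fun h' ↦ absurd h'.1 hp⟩
  · rw [ncard_setOf_eq_card_filter_powerset_half 36 hHcm (fun Φ : CMType K => cmTypeRank Φ = 4)
      (fun S => ((unitResidues 36).filter fun t => ∀ c ∈ unitResidues 36, (c * t ∈ S ↔ c ∈ S)).card = 2) (fun Φ => (cmTypeRank_eq_four_iff_and_eq_two_iff_thirtySix Φ).1)]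
    exact card_filter_card_stabilizer_thirtySix'.1
  · rw [ncard_setOf_eq_card_filter_powerset_half 36 hHcm (fun Φ : CMType K => cmTypeRank Φ = 2)
      (fun S => ((unitResidues 36).filter fun t => ∀ c ∈ unitResidues 36, (c * t ∈ S ↔ c ∈ S)).card = 6) (fun Φ => (cmTypeRank_eq_four_iff_and_eq_two_iff_thirtySix Φ).2)]
    exact card_filter_card_stabilizer_thirtySix'.2

end ThirtySix

section ThirtySixTori

variable {ι : Type} [Fintype ι] [DecidableEq ι] {E : Type} [NormedAddCommGroup E] [NormedSpace ℂ E]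
  {P : (ι → ℝ) ≃L[ℝ] E}

set_option backward.isDefEq.respectTransparency false in -- Mathlib's instance
-- `IsCyclotomicExtension {36} ℚ (CyclotomicField 36 ℚ)` is keyed on `CyclotomicField.algebra`, the goal on `DivisionRing.toRatAlgebra`
/-- **`rank MT(X) ∈ {7, 6, 4, 2}` for every complex torus with an endomorphism of characteristic polynomial `Φ₃₆`**, with `rank MT(X) ≥ 6 ⟺ X` simple
(`7, 6` for the simple ones; `4` when `X ∼ B²` with `B` a simple CM threefold of a sextic subfield, `2` when `X ∼ E⁶`).
[cite: Dodson1984, §3.1.0 and Thm. 3.2.1] [cite: Dodson1987, §1.1 (p. 50)] [cite: MoonenZarhin1999LowDim, §1 (1.2)] -/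
theorem mtRank_hodgeStructure_mem_and_isSimple_iff_thirtySix [HodgeTensorFacts.{0, 0}] {A : Matrix ι ι ℤ} (hA : A ∈ endRingInt P)
    (hP : A.charpoly = cyclotomic 36 ℤ) :
    ((hodgeStructure P 1).mtRank = 7 ∨ (hodgeStructure P 1).mtRank = 6 ∨ (hodgeStructure P 1).mtRank = 4 ∨ (hodgeStructure P 1).mtRank = 2) ∧
      (ComplexTorus.IsSimple P ↔ 6 ≤ (hodgeStructure P 1).mtRank) := by
  have hζ := IsCyclotomicExtension.zeta_spec 36 ℚ (CyclotomicField 36 ℚ)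
  obtain ⟨Φ, I, e, he, he₂, -⟩ := exists_cmType_ideal_iso_of_charpoly_eq_cyclotomic hζ hA hP
  haveI : IsCMField (CyclotomicField 36 ℚ) :=
    IsCyclotomicExtension.Rat.isCMField (CyclotomicField 36 ℚ) (S := ({36} : Set ℕ)) ⟨36, rfl, by norm_num⟩
  obtain ⟨φ₀⟩ : Nonempty (CyclotomicField 36 ℚ →+* ℂ) := inferInstance
  have hXiso : IsIsomorphic P (periodIso Φ I) := ⟨e, he, he₂⟩
  rw [IsIsomorphic.mtRank_hodgeStructure_eq P (periodIso Φ I) (k := 1) hXiso, mtRank_hodgeStructure_periodIso_eq_cmTypeRank Φ I,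
    hXiso.isSimple_iff, isSimple_periodIso_iff_isPrimitive Φ I φ₀]
  exact ⟨cmTypeRank_mem_thirtySix Φ, isPrimitive_iff_six_le_cmTypeRank_thirtySix Φ φ₀⟩

end ThirtySixTori

end ComplexTorus

end Literature.Geometry.Kaehler

end
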